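/-
Copyright (c) 2026 the pub-hodgecm-mathlib formalisation cell (harness21).  Prover seat hodgecm-mathlib-A-p12 (g26): line LH4, DYADIC pay-down of `stub_N6ns`
(dealer LH4-plan (g3) word #6 2026-09-02T07:08Z, brick «SPAN-dy-unr», CM half); 2026-09-02.
-/
import Literature.NumberTheory.Rogawski1990.UnitaryThreeUnipotentClosedFiltrationCM      -- ★ p849265 (LH3-p02 (g0)): `exists_enum_unipotent_isClosed_iUnion_lt` (hypothesis form); brings ★ p849223 `UnitaryThreeUnipotentStrataCM` (§2 transport at `T = 1`, (S1)(S2) odd)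
import Literature.NumberTheory.Automorphic.UnitaryThreeTransvectionClassOpenOfNorm        -- ★ (this seat) FILE A: `exists_isOpen_transvection_class_of_unramifiedLocalConjDatum` (matrix half, norm-hypothesis form)
import Literature.NumberTheory.Automorphic.HyperspecialUnitaryCartanAdicCompletion         -- ★ `unramifiedLocalConjDatum_adicCompletion` (the unramified datum at `w`, no condition on the residue characteristic)
import HarnessLib

/-!
# The unipotent variety of `U(Φ₃)(L⁺_v)` at an UNRAMIFIED non-split place — ANY residue characteristic: closed strata, each unipotent class open in its stratum, and
# the closed enumeration of the unipotent classes (Rogawski 1990 §3.9 Prop. 3.9.1; Bernstein–Zelevinsky 1976 §1.5; Serre, Local Fields V §2)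

Topic `NumberTheory/Rogawski1990`; namespace `Literature.NumberTheory.Rogawski1990`.  THEOREMS ONLY (no definition, no instance, no notation, no named fact, no `sorry`);
kernel lane `--supports stmt-HodgeConjecture-24833`.  Cell `pub/hodgecm-mathlib` (D-0151), crux H413 = `stmt-HodgeConjecture-24833`; line LH4, the DYADIC pay-down leaf
`Cruxes/H413/Lines/F0_P3c_DyadicPaydown.lean` ED. 1 (LH4-plan (g3) skeleton v1 0447f09394670f4b; organs (D-SH) (D-UNR) (D-RAM) over ★ `n6nsDyadic_of_dyadicAntidiag`),
organ **(D-SH)** «Shalika at `Φ₃` at dyadic non-split places», in-house road at UNRAMIFIED dyadic `w` (dealer board after words #5∕#6: ‹U-FIN-unr› LH5-p03, ‹RAO› LH10-p01,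
‹DUAL-unr› F0P3a-p04, ‹SPAN-unr› THIS FILE, ‹SPAN-e› ★ parity-free), brick **«SPAN-dy-unr»**: the `hfilt` input of the Howe ∕ Harish-Chandra span property (organ ‹SPAN› of
the leaf, ★ `stub_ShSpan_of_spanE` pattern of `F0_P3c_ShalikaPaydown`) at an UNRAMIFIED non-split place, with NO hypothesis on the residue characteristic.

THE TEXTS.  (S1u) `isClosed_setOf_sub_one_pow_eq_zero_unramified` and (S2u) `exists_isOpen_forall_sameStratum_mem_iff_isConj_unramified` are ★ p849223's (S1) ∕ (S2)
(`UnitaryThreeUnipotentStrataCM` :134 ∕ :154) with the ONE token `IsUnit (2 : 𝒪[w.1.adicCompletion L]) →` replaced by `Algebra.IsUnramifiedIn (𝓞 L) v.asIdeal →` AT THE SAME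
POSITION and nothing else; the corollary `exists_enum_unipotent_isClosed_iUnion_lt_antidiagOne_unramified` is ★ p849265's `…_antidiagOne_odd` (:203) with `(h2 : IsUnit …)` ↦
`(hv : Algebra.IsUnramifiedIn (𝓞 L) v.asIdeal)`, over the parity-free hypothesis form ★ `exists_enum_unipotent_isClosed_iUnion_lt`.  ((S3) of ★ p849223 — locally closed classes,
closure in the `≤`-stratum — is not on the ‹SPAN› path and is not re-typed here.)

WHERE `2 ∈ 𝒪_w^×` WAS LOAD-BEARING, AND WHY UNRAMIFIED SUFFICES (census).  (S1) never used it (continuity of `γ ↦ (ψγ − 1)^k` only; the binder is carried for the organ's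
uniform prefix — here `_hv`, equally idle).  (S2): order `1` and order `3` are residue-characteristic free (the regular unipotent class of `U(σ_w, J₀)(L_w)` is unique as soon
as `2 ≠ 0` IN THE FIELD, ★ `exists_conj_eq_of_regular_unipotent … (h2K : (2 : L_w) ≠ 0)`, and `L_w` has characteristic `0`); order `2` (transvections) used `|2|_w = 1` at exactly
ONE step of ★ `exists_isOpen_transvection_class` — «a `σ_w`-fixed principal unit is a norm» by Hensel on `X² − a`.  At an UNRAMIFIED place that step is
«`N(U_w^n) = U_v^n`, `n ≥ 1`» [Serre1979, Ch. V §2 Prop. 3], true at EVERY residue characteristic and already in the tree as the (norm) field of ★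
`unramifiedLocalConjDatum_adicCompletion … (hv)`; FILE A ★ `exists_isOpen_transvection_class_of_unramifiedLocalConjDatum` is the matrix half in that form.  So the whole file is
the ★ odd proof with `h2v` ↦ `hd.norm` and `h2K` from `CharZero`.

* §1 **(S1u)** `isClosed_setOf_sub_one_pow_eq_zero_unramified`, **(S2u)** `exists_isOpen_forall_sameStratum_mem_iff_isConj_unramified`;
* §2 **`exists_enum_unipotent_isClosed_iUnion_lt_antidiagOne_unramified`** (the closed enumeration = `hfilt` of ‹SPAN›, unramified non-split `v`, any residue characteristic).

HONEST LABEL: HC_CM is proved only modulo the 7 printed citations (2 remaining named inputs: hLiu418 = stmt-HodgeConjecture-24832, h413 = stmt-HodgeConjecture-24833) until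
rung 0 closes; this file is in-house point-set topology ∕ linear algebra over a local field, count-neutral (a brick of organ (D-SH)'s in-house road at UNRAMIFIED dyadic places;
the dyadic print row `N6nsDyadicStatement` of the closer moves only if a desk edition consumes the whole road).

## References
* [Rogawski1990] J. D. Rogawski, *Automorphic Representations of Unitary Groups in Three Variables*, Ann. of Math. Stud. 123 (1990), §3.9 p. 32, Prop. 3.9.1 (unipotent
  classes of `U(3)`: regular class unique; singular classes `[n(t)]`, `t ∈ E⁰∕N E^×`); §8.1 pp. 112–113 (the germ expansion's use of the unipotent classes).
* [BernsteinZelevinsky1976] I. N. Bernstein, A. V. Zelevinsky, *Representations of the group GL(n, F) where F is a non-archimedean local field*, Russian Math. Surveys 31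
  (1976), §1.5 (l-spaces: locally closed subsets, stratifications).
* [Serre1979] J.-P. Serre, *Local Fields*, GTM 67 (1979), Ch. V §2 Prop. 3 (`N(U_L^n) = U_K^n`, unramified case, any residue characteristic).
* [PlatonovRapinchuk1994] V. Platonov, A. Rapinchuk, *Algebraic Groups and Number Theory* (1994), §3.1 (topology on `G(K_v)`), §5.1.
-/

set_option autoImplicit false

noncomputable section

open scoped Valued WithZero Matrix MatrixGroups
open Topology Set NumberField IsDedekindDomain Matrix

namespace Literature.NumberTheory.Rogawski1990

open Literature.NumberTheory.Automorphic Literature.NumberTheory.Automorphic.UnitaryGroup Literature.NumberTheory.GaloisRepresentations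
open Literature.NumberTheory.Automorphic.HermitianLattice

/-! ## §1 The heads (S1u), (S2u) on `G = U(Φ₃)(L⁺_v)` at an UNRAMIFIED non-split place (leaf ED. 1 binder prefix with `IsUnit 2 ↦ IsUnramifiedIn`) -/

section Heads

/-- **(S1u) CLOSED STRATA** at an unramified non-split place: for every `k`, `{γ ∈ U(Φ₃)(L⁺_v) | (γ − 1)^k = 0}` is closed (the matrix coefficients are continuous on the local
carrier; the place hypotheses are carried for the organ's uniform binder prefix — only continuity is used).  = ★ `isClosed_setOf_sub_one_pow_eq_zero` with the token
`IsUnit (2 : 𝒪[w.1.adicCompletion L]) →` replaced by `Algebra.IsUnramifiedIn (𝓞 L) v.asIdeal →`. [cite: Rogawski1990, §3.9 p. 32] [cite: BernsteinZelevinsky1976, §1.5] -/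
theorem isClosed_setOf_sub_one_pow_eq_zero_unramified :
    ∀ (L : Type) [Field L] [NumberField L] [IsCMField L] (v : HeightOneSpectrum (𝓞 ↥(maximalRealSubfield L))) (w : UnitaryGroup.PlacesOver L v),
      Subsingleton (UnitaryGroup.PlacesOver L v) → Algebra.IsUnramifiedIn (𝓞 L) v.asIdeal →
      ∀ k : ℕ, IsClosed {γ : (cmDatum L 3 (Matrix.of fun i j : Fin 3 => if i.val + j.val + 1 = 3 then (1 : L) else 0)).Local v | ((γ.val : GL (Fin 3) (UnitaryGroup.LocalRing L v)).val - 1) ^ k = 0} := by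
  intro L _ _ _ v w hsub _ k
  have hw : IsCMField.complexConj L • w.1 = w.1 := smul_placesOver_eq_of_subsingleton L v (IsCMField.complexConj L) hsub w
  have hset : {γ : (cmDatum L 3 (Matrix.of fun i j : Fin 3 => if i.val + j.val + 1 = 3 then (1 : L) else 0)).Local v | ((γ.val : GL (Fin 3) (UnitaryGroup.LocalRing L v)).val - 1) ^ k = 0} =
      (fun y : (cmDatum L 3 (Matrix.of fun i j : Fin 3 => if i.val + j.val + 1 = 3 then (1 : L) else 0)).Local v => ((1 : GL (Fin 3) (w.1.adicCompletion L)) * ((localNonsplitEquiv (IsCMField.complexConj L) (Matrix.of fun i j : Fin 3 => if i.val + j.val + 1 = 3 then (1 : L) else 0) (IsCMField.complexConj_ne_one L) w hw y : ↥(unitaryGroupOfForm (galAdicCompletionMap (L := L) (IsCMField.complexConj L) hw) (placeForm (Matrix.of fun i j : Fin 3 => if i.val + j.val + 1 = 3 then (1 : L) else 0) w.1))) : GL (Fin 3) (w.1.adicCompletion L)) * (1 : GL (Fin 3) (w.1.adicCompletion L))⁻¹)) ⁻¹' {g : GL (Fin 3) (w.1.adicCompletion L) | ((g : Matrix (Fin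 3) (Fin 3) (w.1.adicCompletion L)) - 1) ^ k = 0} := by
    ext γ
    exact sub_one_pow_eq_zero_iff_conj_localNonsplitEquiv L w hw hsub γ k
  rw [hset]
  exact (isClosed_setOf_coe_sub_one_pow_eq_zero k).preimage (continuous_conj_localNonsplitEquiv_one L w hw)

/-- **(S2u) STRATA-OPEN — EVERY UNIPOTENT CLASS OF `U(Φ₃)(L⁺_v)` IS CUT OUT BY AN OPEN SET INSIDE ITS STRATUM, at an UNRAMIFIED non-split place of ANY residue
characteristic.**  With `SameStratum u γ :≡ (γ−1)³ = 0 ∧ ((γ−1)² = 0 ↔ (u−1)² = 0) ∧ (γ = 1 ↔ u = 1)` (spelled inline): for every unipotent `u` there is an OPEN `V ⊆ G` with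
`γ ∈ V ↔ IsConj u γ` for all `γ` in the stratum of `u`.  By [Rogawski1990, §3.9 Prop. 3.9.1]: order `3` — `V = univ`, the regular unipotent class is UNIQUE (`2 ≠ 0` in the
characteristic-`0` field `L_w`, ★ `exists_conj_eq_of_regular_unipotent`); order `2` — the transvection classes `[n(t)]` are told apart by the norm class of the invariant
`B₀(x, (γ−1)x) ∈ t·N(L_w)`, LOCALLY CONSTANT because a `σ_w`-fixed principal unit is a norm at an UNRAMIFIED place («`N(U_w^n) = U_v^n`», [Serre1979, Ch. V §2 Prop. 3],
★ `unramifiedLocalConjDatum_adicCompletion` + ★ FILE A `exists_isOpen_transvection_class_of_unramifiedLocalConjDatum`); order `1` — `V = univ`.  = ★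
`exists_isOpen_forall_sameStratum_mem_iff_isConj` with the token `IsUnit (2 : 𝒪[w.1.adicCompletion L]) →` replaced by `Algebra.IsUnramifiedIn (𝓞 L) v.asIdeal →`.
[cite: Rogawski1990, §3.9 p. 32, Prop. 3.9.1] [cite: Serre1979, Ch. V §2 Prop. 3] [cite: BernsteinZelevinsky1976, §1.5] -/
theorem exists_isOpen_forall_sameStratum_mem_iff_isConj_unramified :
    ∀ (L : Type) [Field L] [NumberField L] [IsCMField L] (v : HeightOneSpectrum (𝓞 ↥(maximalRealSubfield L))) (w : UnitaryGroup.PlacesOver L v),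
      Subsingleton (UnitaryGroup.PlacesOver L v) → Algebra.IsUnramifiedIn (𝓞 L) v.asIdeal →
      ∀ u : (cmDatum L 3 (Matrix.of fun i j : Fin 3 => if i.val + j.val + 1 = 3 then (1 : L) else 0)).Local v, ((u.val : GL (Fin 3) (UnitaryGroup.LocalRing L v)).val - 1) ^ 3 = 0 →
        ∃ V : Set ((cmDatum L 3 (Matrix.of fun i j : Fin 3 => if i.val + j.val + 1 = 3 then (1 : L) else 0)).Local v), IsOpen V ∧
          ∀ γ : (cmDatum L 3 (Matrix.of fun i j : Fin 3 => if i.val + j.val + 1 = 3 then (1 : L) else 0)).Local v, (((γ.val : GL (Fin 3) (UnitaryGroup.LocalRing L v)).val - 1) ^ 3 = 0 ∧ (((γ.val : GL (Fin 3) (UnitaryGroup.LocalRing L v)).val - 1) ^ 2 = 0 ↔ ((u.val : GL (Fin 3) (UnitaryGroup.LocalRing L v)).val - 1) ^ 2 = 0) ∧ (γ = 1 ↔ u = 1)) →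
            (γ ∈ V ↔ IsConj u γ) := by
  intro L _ _ _ v w hsub hv u hu3
  have hw : IsCMField.complexConj L • w.1 = w.1 := smul_placesOver_eq_of_subsingleton L v (IsCMField.complexConj L) hsub w
  haveI : CharZero (w.1.adicCompletion L) := charZero_of_injective_algebraMap (algebraMap L _).injective
  have h2K : (2 : (w.1.adicCompletion L)) ≠ 0 := two_ne_zero
  have hσ : ∀ z : (w.1.adicCompletion L), (galAdicCompletionMap (L := L) (IsCMField.complexConj L) hw) ((galAdicCompletionMap (L := L) (IsCMField.complexConj L) hw) z) = z := galAdicCompletionMap_involutive L v w hw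
  -- the unramified datum at `w`: (norm) «a `σ_w`-fixed principal unit is a norm», any residue characteristic
  obtain ⟨ϖ, hd⟩ := unramifiedLocalConjDatum_adicCompletion (IsCMField.complexConj L) (IsCMField.complexConj_ne_one L) v w hw hv
  have hT := placeForm_antidiagOne_eq_formCongr_one L w hw
  -- `ψ(y) ∈ U(σ_w, J₀)`
  have hmem : ∀ y : (cmDatum L 3 (Matrix.of fun i j : Fin 3 => if i.val + j.val + 1 = 3 then (1 : L) else 0)).Local v, ((1 : GL (Fin 3) (w.1.adicCompletion L)) * ((localNonsplitEquiv (IsCMField.complexConj L) (Matrix.of fun i j : Fin 3 => if i.val + j.val + 1 = 3 then (1 : L) else 0) (IsCMField.complexConj_ne_one L) w hw y : ↥(unitaryGroupOfForm (galAdicCompletionMap (L := L) (IsCMField.complexConj L) hw) (placeForm (Matrix.of fun i j : Fin 3 => if i.val + j.val + 1 = 3 then (1 : L) else 0) w.1))) : GL (Fin 3) (w.1.adicCompletion L)) * (1 : GL (Fin 3) (w.1.adicCompletion L))⁻¹) ∈ unitaryGroupOfForm (galAdicCompletionMap (L := L) (IsCMField.complexConj L) hw) ((StdForm.antidiagonal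 3).over (w.1.adicCompletion L)) := fun y => conj_localNonsplitEquiv_mem L (Matrix.of fun i j : Fin 3 => if i.val + j.val + 1 = 3 then (1 : L) else 0) v w hw hT y
  by_cases hu1 : u = 1
  · -- order 1: the stratum of `1` is `{1}`
    refine ⟨Set.univ, isOpen_univ, fun γ hγ => ⟨fun _ => ?_, fun _ => Set.mem_univ _⟩⟩
    rw [hu1, hγ.2.2.2 hu1]
  by_cases hu2 : ((u.val : GL (Fin 3) (UnitaryGroup.LocalRing L v)).val - 1) ^ 2 = 0
  · -- order 2: transvections
    have hψ2 : ((((((1 : GL (Fin 3) (w.1.adicCompletion L)) * ((localNonsplitEquiv (IsCMField.complexConj L) (Matrix.of fun i j : Fin 3 => if i.val + j.val + 1 = 3 then (1 : L) else 0) (IsCMField.complexConj_ne_one L) w hw u : ↥(unitaryGroupOfForm (galAdicCompletionMap (L := L) (IsCMField.complexConj L) hw) (placeForm (Matrix.of fun i j : Fin 3 => if i.val + j.val + 1 = 3 then (1 : L) else 0) w.1))) : GL (Fin 3) (w.1.adicCompletion L)) * (1 : GL (Fin 3) (w.1.adicCompletion L))⁻¹) : GL (Fin 3) (w.1.adicCompletion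 L)) : Matrix (Fin 3) (Fin 3) (w.1.adicCompletion L)) - 1)) * ((((((1 : GL (Fin 3) (w.1.adicCompletion L)) * ((localNonsplitEquiv (IsCMField.complexConj L) (Matrix.of fun i j : Fin 3 => if i.val + j.val + 1 = 3 then (1 : L) else 0) (IsCMField.complexConj_ne_one L) w hw u : ↥(unitaryGroupOfForm (galAdicCompletionMap (L := L) (IsCMField.complexConj L) hw) (placeForm (Matrix.of fun i j : Fin 3 => if i.val + j.val + 1 = 3 then (1 : L) else 0) w.1))) : GL (Fin 3) (w.1.adicCompletion L)) * (1 : GL (Fin 3) (w.1.adicCompletion L))⁻¹) : GL (Fin 3) (w.1.adicCompletion L)) : Matrix (Fin 3) (Fin 3) (w.1.adicCompletion L)) - 1)) = 0 := by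
      rw [← pow_two]; exact (sub_one_pow_eq_zero_iff_conj_localNonsplitEquiv L w hw hsub u 2).1 hu2
    have hψ1 : ((1 : GL (Fin 3) (w.1.adicCompletion L)) * ((localNonsplitEquiv (IsCMField.complexConj L) (Matrix.of fun i j : Fin 3 => if i.val + j.val + 1 = 3 then (1 : L) else 0) (IsCMField.complexConj_ne_one L) w hw u : ↥(unitaryGroupOfForm (galAdicCompletionMap (L := L) (IsCMField.complexConj L) hw) (placeForm (Matrix.of fun i j : Fin 3 => if i.val + j.val + 1 = 3 then (1 : L) else 0) w.1))) : GL (Fin 3) (w.1.adicCompletion L)) * (1 : GL (Fin 3) (w.1.adicCompletion L))⁻¹) ≠ 1 := fun h => hu1 ((conj_localNonsplitEquiv_eq_one_iff L w hw u).1 h)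
    obtain ⟨V₀, hV₀, hcls, hconv⟩ := exists_isOpen_transvection_class_of_unramifiedLocalConjDatum (galAdicCompletionMap (L := L) (IsCMField.complexConj L) hw) hd (hmem u) hψ2 hψ1
    refine ⟨(fun y : (cmDatum L 3 (Matrix.of fun i j : Fin 3 => if i.val + j.val + 1 = 3 then (1 : L) else 0)).Local v => ((1 : GL (Fin 3) (w.1.adicCompletion L)) * ((localNonsplitEquiv (IsCMField.complexConj L) (Matrix.of fun i j : Fin 3 => if i.val + j.val + 1 = 3 then (1 : L) else 0) (IsCMField.complexConj_ne_one L) w hw y : ↥(unitaryGroupOfForm (galAdicCompletionMap (L := L) (IsCMField.complexConj L) hw) (placeForm (Matrix.of fun i j : Fin 3 => if i.val + j.val + 1 = 3 then (1 : L) else 0) w.1))) : GL (Fin 3) (w.1.adicCompletion L)) * (1 : GL (Fin 3) (w.1.adicCompletion L))⁻¹)) ⁻¹' V₀, hV₀.preimage (continuous_conj_localNonsplitEquiv_one L w hw), fun γ hγ => ?_⟩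
    obtain ⟨hγ3, hγ2, hγ1⟩ := hγ
    have hγ2' : ((γ.val : GL (Fin 3) (UnitaryGroup.LocalRing L v)).val - 1) ^ 2 = 0 := hγ2.2 hu2
    have hγne : γ ≠ 1 := fun h => hu1 (hγ1.1 h)
    constructor
    · intro hV
      have hψγ2 : ((((((1 : GL (Fin 3) (w.1.adicCompletion L)) * ((localNonsplitEquiv (IsCMField.complexConj L) (Matrix.of fun i j : Fin 3 => if i.val + j.val + 1 = 3 then (1 : L) else 0) (IsCMField.complexConj_ne_one L) w hw γ : ↥(unitaryGroupOfForm (galAdicCompletionMap (L := L) (IsCMField.complexConj L) hw) (placeForm (Matrix.of fun i j : Fin 3 => if i.val + j.val + 1 = 3 then (1 : L) else 0) w.1))) : GL (Fin 3) (w.1.adicCompletion L)) * (1 : GL (Fin 3) (w.1.adicCompletion L))⁻¹) : GL (Fin 3) (w.1.adicCompletion L)) : Matrix (Fin 3) (Fin 3) (w.1.adicCompletion L)) - 1)) * ((((((1 : GL (Fin 3) (w.1.adicCompletion L)) * ((localNonsplitEquiv (IsCMField.complexConj L) (Matrix.of fun i j : Fin 3 => if i.val + j.val + 1 = 3 then (1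 : L) else 0) (IsCMField.complexConj_ne_one L) w hw γ : ↥(unitaryGroupOfForm (galAdicCompletionMap (L := L) (IsCMField.complexConj L) hw) (placeForm (Matrix.of fun i j : Fin 3 => if i.val + j.val + 1 = 3 then (1 : L) else 0) w.1))) : GL (Fin 3) (w.1.adicCompletion L)) * (1 : GL (Fin 3) (w.1.adicCompletion L))⁻¹) : GL (Fin 3) (w.1.adicCompletion L)) : Matrix (Fin 3) (Fin 3) (w.1.adicCompletion L)) - 1)) = 0 := by
        rw [← pow_two]; exact (sub_one_pow_eq_zero_iff_conj_localNonsplitEquiv L w hw hsub γ 2).1 hγ2'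
      have hψγ1 : ((1 : GL (Fin 3) (w.1.adicCompletion L)) * ((localNonsplitEquiv (IsCMField.complexConj L) (Matrix.of fun i j : Fin 3 => if i.val + j.val + 1 = 3 then (1 : L) else 0) (IsCMField.complexConj_ne_one L) w hw γ : ↥(unitaryGroupOfForm (galAdicCompletionMap (L := L) (IsCMField.complexConj L) hw) (placeForm (Matrix.of fun i j : Fin 3 => if i.val + j.val + 1 = 3 then (1 : L) else 0) w.1))) : GL (Fin 3) (w.1.adicCompletion L)) * (1 : GL (Fin 3) (w.1.adicCompletion L))⁻¹) ≠ 1 := fun h => hγne ((conj_localNonsplitEquiv_eq_one_iff L w hw γ).1 h)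
      obtain ⟨k, hk, hkc⟩ := hconv _ (hmem γ) hψγ2 hψγ1 hV
      exact (isConj_iff_exists_conj_localNonsplitEquiv L w hw u γ).2 ⟨k, hk, hkc⟩
    · intro hc
      obtain ⟨k, hk, hkc⟩ := (isConj_iff_exists_conj_localNonsplitEquiv L w hw u γ).1 hc
      show ((1 : GL (Fin 3) (w.1.adicCompletion L)) * ((localNonsplitEquiv (IsCMField.complexConj L) (Matrix.of fun i j : Fin 3 => if i.val + j.val + 1 = 3 then (1 : L) else 0) (IsCMField.complexConj_ne_one L) w hw γ : ↥(unitaryGroupOfForm (galAdicCompletionMap (L := L) (IsCMField.complexConj L) hw) (placeForm (Matrix.of fun i j : Fin 3 => if i.val + j.val + 1 = 3 then (1 : L) else 0) w.1))) : GL (Fin 3) (w.1.adicCompletion L)) * (1 : GL (Fin 3) (w.1.adicCompletion L))⁻¹) ∈ V₀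
      rw [← hkc]
      exact hcls k hk
  · -- order 3: regular unipotents form ONE class (`2 ≠ 0` in the field)
    refine ⟨Set.univ, isOpen_univ, fun γ hγ => ⟨fun _ => ?_, fun _ => Set.mem_univ _⟩⟩
    obtain ⟨hγ3, hγ2, -⟩ := hγ
    have hγ2' : ¬ ((γ.val : GL (Fin 3) (UnitaryGroup.LocalRing L v)).val - 1) ^ 2 = 0 := fun h => hu2 (hγ2.1 h)
    have hnil : ∀ y : (cmDatum L 3 (Matrix.of fun i j : Fin 3 => if i.val + j.val + 1 = 3 then (1 : L) else 0)).Local v, ((y.val : GL (Fin 3) (UnitaryGroup.LocalRing L v)).val - 1) ^ 3 = 0 → IsNilpotent (((((1 : GL (Fin 3) (w.1.adicCompletion L)) * ((localNonsplitEquiv (IsCMField.complexConj L) (Matrix.of fun i j : Fin 3 => if i.val + j.val + 1 = 3 then (1 : L) else 0) (IsCMField.complexConj_ne_one L) w hw y : ↥(unitaryGroupOfForm (galAdicCompletionMap (L := L) (IsCMField.complexConj L) hw) (placeForm (Matrix.of fun i j : Fin 3 => if i.val + j.val + 1 = 3 then (1 : L) else 0) w.1))) : GL (Fin 3) (w.1.adicCompletion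 L)) * (1 : GL (Fin 3) (w.1.adicCompletion L))⁻¹) : GL (Fin 3) (w.1.adicCompletion L)) : Matrix (Fin 3) (Fin 3) (w.1.adicCompletion L)) - 1) :=
      fun y hy => ⟨3, (sub_one_pow_eq_zero_iff_conj_localNonsplitEquiv L w hw hsub y 3).1 hy⟩
    have hreg : ∀ y : (cmDatum L 3 (Matrix.of fun i j : Fin 3 => if i.val + j.val + 1 = 3 then (1 : L) else 0)).Local v, ¬ ((y.val : GL (Fin 3) (UnitaryGroup.LocalRing L v)).val - 1) ^ 2 = 0 →
        ((((((1 : GL (Fin 3) (w.1.adicCompletion L)) * ((localNonsplitEquiv (IsCMField.complexConj L) (Matrix.of fun i j : Fin 3 => if i.val + j.val + 1 = 3 then (1 : L) else 0) (IsCMField.complexConj_ne_one L) w hw y : ↥(unitaryGroupOfForm (galAdicCompletionMap (L := L) (IsCMField.complexConj L) hw) (placeForm (Matrix.of fun i j : Fin 3 => if i.val + j.val + 1 = 3 then (1 : L) else 0) w.1))) : GL (Fin 3) (w.1.adicCompletion L)) * (1 : GL (Fin 3) (w.1.adicCompletion L))⁻¹) : GL (Fin 3) (w.1.adicCompletion L))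 : Matrix (Fin 3) (Fin 3) (w.1.adicCompletion L)) - 1)) * ((((((1 : GL (Fin 3) (w.1.adicCompletion L)) * ((localNonsplitEquiv (IsCMField.complexConj L) (Matrix.of fun i j : Fin 3 => if i.val + j.val + 1 = 3 then (1 : L) else 0) (IsCMField.complexConj_ne_one L) w hw y : ↥(unitaryGroupOfForm (galAdicCompletionMap (L := L) (IsCMField.complexConj L) hw) (placeForm (Matrix.of fun i j : Fin 3 => if i.val + j.val + 1 = 3 then (1 : L) else 0) w.1))) : GL (Fin 3) (w.1.adicCompletion L)) * (1 : GL (Fin 3) (w.1.adicCompletion L))⁻¹) : GL (Fin 3) (w.1.adicCompletion L)) : Matrix (Fin 3) (Fin 3) (w.1.adicCompletion L)) - 1)) ≠ 0 :=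
      fun y hy h => hy ((sub_one_pow_eq_zero_iff_conj_localNonsplitEquiv L w hw hsub y 2).2 (by rw [pow_two]; exact h))
    obtain ⟨k, hk, hkc⟩ := exists_conj_eq_of_regular_unipotent (galAdicCompletionMap (L := L) (IsCMField.complexConj L) hw) hσ h2K (hmem u) (hmem γ) (hnil u hu3) (hnil γ hγ3) (hreg u hu2) (hreg γ hγ2')
    exact (isConj_iff_exists_conj_localNonsplitEquiv L w hw u γ).2 ⟨k, hk, hkc⟩

end Heads

/-! ## §2 The closed enumeration of the unipotent classes at an UNRAMIFIED non-split place (`hfilt` of ‹SPAN›), (S1u)(S2u) discharged -/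

set_option maxHeartbeats 400000 in
-- statement-heavy carrier (as in ★ `…_antidiagOne_odd`)
/-- **The closed enumeration of the unipotent classes of `U(Φ₃)(L⁺_v)` at an UNRAMIFIED non-split place, any residue characteristic** — UNCONDITIONAL: (S1u) and (S2u)
discharge the hypotheses of ★ `exists_enum_unipotent_isClosed_iUnion_lt`.  For every finite `S` with `c ∈ S ↔ (γ_c − 1)³ = 0`: `∃ n (e : Fin n → ConjClasses G),
(∀ c, c ∈ S ↔ ∃ i, e i = c) ∧ ∀ k, IsClosed (⋃_{i<k} 𝒪(e i))` — the `hfilt` input of the Howe ∕ Harish-Chandra span property for the unipotent orbital integrals of `U(3)`.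
= ★ `exists_enum_unipotent_isClosed_iUnion_lt_antidiagOne_odd` with `(h2 : IsUnit (2 : 𝒪[w.1.adicCompletion L]))` replaced by `(hv : Algebra.IsUnramifiedIn (𝓞 L) v.asIdeal)`.
[cite: Rogawski1990, §3.9 Prop. 3.9.1 p. 32; §8.1 pp. 112–113] [cite: BernsteinZelevinsky1976, §1.5] -/
theorem exists_enum_unipotent_isClosed_iUnion_lt_antidiagOne_unramified (L : Type) [Field L] [NumberField L] [IsCMField L]
    (v : HeightOneSpectrum (𝓞 ↥(maximalRealSubfield L))) (w : UnitaryGroup.PlacesOver L v) (hsub : Subsingleton (UnitaryGroup.PlacesOver L v))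
    (hv : Algebra.IsUnramifiedIn (𝓞 L) v.asIdeal)
    (S : Finset (ConjClasses ((cmDatum L 3 (Matrix.of fun i j : Fin 3 => if i.val + j.val + 1 = 3 then (1 : L) else 0)).Local v)))
    (hS : ∀ c : ConjClasses ((cmDatum L 3 (Matrix.of fun i j : Fin 3 => if i.val + j.val + 1 = 3 then (1 : L) else 0)).Local v), c ∈ S ↔
      (((Quotient.out c : (cmDatum L 3 (Matrix.of fun i j : Fin 3 => if i.val + j.val + 1 = 3 then (1 : L) else 0)).Local v).val : GL (Fin 3) (UnitaryGroup.LocalRing L v)).val - 1) ^ 3 = 0) :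
    ∃ (n : ℕ) (e : Fin n → ConjClasses ((cmDatum L 3 (Matrix.of fun i j : Fin 3 => if i.val + j.val + 1 = 3 then (1 : L) else 0)).Local v)),
      (∀ c, c ∈ S ↔ ∃ i, e i = c) ∧ ∀ k : ℕ, IsClosed (⋃ (i : Fin n) (_ : i.val < k), (e i).carrier) :=
  exists_enum_unipotent_isClosed_iUnion_lt L _ v S hS (isClosed_setOf_sub_one_pow_eq_zero_unramified L v w hsub hv)
    (exists_isOpen_forall_sameStratum_mem_iff_isConj_unramified L v w hsub hv)

end Literature.NumberTheory.Rogawski1990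

end
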